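import Literature.NumberTheory.EllipticCurves.IwasawaTowerTorsionOrdinaryLocalProofs
import HarnessLib

/-!
# `E(ℚ_{p,∞})[p^∞]` is finite at a prime `p` of POTENTIALLY GOOD reduction, for the cyclotomic `ℤ_p`-extension
# (Imai 1975, LOCAL form over a field of good reduction) — ONE named fact, in the schema shape both consumer cells
# already display

Topic `NumberTheory/EllipticCurves` (namespace = path).  ONE `def … : Prop` (named fact, review-queued, net debt +1), no
theorem, no instance, no notation, no `sorry`.  Seat `bsd-potss-rkm` (generation 30, prover, cell `bsd-potss`; crux M =
item stmt-BirchSwinnertonDyer-19196 `ReducibleKatoMember` of the routes K9 / K8-t′).  The SIBLING of the `Proofs` file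
`IwasawaTowerTorsionOrdinaryLocalProofs.lean`, which PROVES the same finiteness at a good ORDINARY odd prime
(`WeierstrassCurve.finite_fixedPoints_kerSubgroup_inf_decomp_of_ordinary`); this file NAMES it at a potentially good prime,
where the tree has no proof (see "Why not a proof" below).  HONEST FRAMING: nothing about BSD or Kato's Main Conjecture is
asserted; the fact is Imai's printed theorem moved to the tree's vocabulary through one standard step (semistable reduction).

## The statement and its print source

For an elliptic curve `W/ℚ`, a prime `p` with `0 ≤ ord_p j(W)` (⟺ `W` has POTENTIALLY GOOD reduction at `p`, Silverman *AEC*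
Prop. VII.5.5), the CYCLOTOMIC `ℤ_p`-extension `κ` of `ℚ` and the place `v` of `ℚ` at `p`: the fixed points of
`ker κ ⊓ D_v` (`ZpExtension.kerSubgroup`, `GreenbergSelmer.decomp v` = the decomposition group of the tree's chosen prime
`adicCompletionPrime ℚ v` above `v`) on `W(ℚ̄)[p^∞] = W.geomPrimaryTorsion p` form a FINITE group — i.e. `W(ℚ_{p,∞})[p^∞]` is
finite, `ℚ_{p,∞}` the cyclotomic `ℤ_p`-extension of `ℚ_p` (any other prime above `v` is conjugate, with isomorphic fixed points).
VERBATIM the hypothesis `hfin` of `Kato2004.exists_iwasawaH2Data_fineSelmerDual_embedding` (H2X, cell `bsd-cm`) and of its sequel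
`Kato2004.exists_iwasawaH2Data_fineSelmerDual_embedding_count` (H2X⁺), and VERBATIM the displayed schema `hImai` of
`Summit….Additive.ContraRealizable.realizableOfKMC_contra_of_thm12_4_of_h2Embedding_of_localFinite` (cell `bsd-cm`) and of
`Summit….Theorems.CoreInputsOfFine.exists_memberHullZetaCoreInputs_of_fineInputs` (cell `bsd-potss`, p677595) — so that THIS ONE
name discharges all four displays.

PRINT: H. Imai, *A remark on the rational points of abelian varieties with values in cyclotomic `ℤ_p`-extensions*, Proc. Japan
Acad. 51 (1975) 12–16, THEOREM (p. 12): for a finite extension `k/ℚ_p` and an abelian variety `A/k` with GOOD reduction,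
the torsion subgroup of `A(k(μ_{p^∞}))` is finite.  READING (two standard steps, both cited): (1) `0 ≤ ord_p j(W)` ⟹ `W` acquires
good reduction over a finite extension `k/ℚ_p` (*AEC* VII.5.5 with VII.5.4 (semistable reduction theorem)); (2)
`ℚ_{p,∞} ⊆ ℚ_p(μ_{p^∞}) ⊆ k(μ_{p^∞})`, so `W(ℚ_{p,∞})[p^∞] ⊆ W(k(μ_{p^∞}))_{tors}` is finite.  WEAKER than print (elliptic curves
over `ℚ`, the `p`-primary part, the cyclotomic `ℤ_p`-layer only), never stronger.  SCOPE: every prime `p` (Imai has no parity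
hypothesis); says nothing when `ord_p j(W) < 0` (there it FAILS for `p` odd exactly at Kato's (12.5.1): `p = 3`, `W/ℚ_3` the
`ω`-twist of a Tate curve — outside the hypothesis).  JUNK AUDIT: not vacuous (the conclusion is false for the excluded Tate-twist
rows, true and NON-trivial on the 168 Kodaira-II rows at `p = 5` with `W(ℚ_5)[5] ≅ ℤ/5` and the 5823 K9 class representatives with
`W(ℚ_3)[3] ≠ 0` of the cell's censuses j319232 / j319256, where the finite group is not zero); on the rows with `W(ℚ_p)[p] = 0` the
conclusion is the KERNEL theorem "`= 0`" (pro-`p` fixed-point trick, `Summit….TowerTorsionVanishing`, seat rkm g26), and at a good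
ordinary odd `p` it is the kernel theorem of the sibling file — the fact is load-bearing only in between.

## Why not a proof (recorded for the literature-prover)

`W(ℚ_{p,∞})[p^∞]` finite ⟺ `(T_pW)^{G_{ℚ_{p,∞}}} = 0`; a non-zero fixed vector spans a `G_{ℚ_p}`-stable subspace on which `G_{ℚ_p}`
acts through `Γ = Gal(ℚ_{p,∞}/ℚ_p) ≅ ℤ_p`.  On potentially ORDINARY rows this is excluded elementarily (the unit-root Frobenius
eigenvalue has complex absolute value `√p`, so is no root of unity; `χ_cyc` has finite image on `G_{k_∞}`) — the sibling file's
method extends.  On potentially SUPERSINGULAR rows a `Γ`-line in `V_pW|_{G_k}` would give `G_k`-stable cyclic subgroups of every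
order `p^n` in a height-two formal group over a FIXED ramified base `𝓞_k` (`e(k/ℚ_p) ≤ 6` for `p ≥ 5`), excluded by the
Lubin–Katz canonical-subgroup ramification bounds or by Sen's theory of Hodge–Tate weights (Imai's own proof) — neither formal
groups over ramified `p`-adic integer rings nor Sen theory are in the tree.  Hence a named fact.

## References

* H. Imai, Proc. Japan Acad. 51 (1975) 12–16, Theorem (p. 12). [Imai1975]
* J. H. Silverman, *The Arithmetic of Elliptic Curves*, 2nd ed. (2009), Prop. VII.5.4 (c), Prop. VII.5.5. [SilvermanAEC2009]
* J-P. Serre, J. Tate, *Good reduction of abelian varieties*, Ann. of Math. 88 (1968), Thm. 1–2 (context: potential good reduction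
  is detected by inertia at `ℓ ≠ p`). [SerreTateAnnals1968]
* R. Greenberg, LNM 1716 (1999), §1 p. 62 ("The crucial step is to show that `E(F_∞)_{tors}` is finite … See also [Im]"). [GreenbergLNM1716]
* K. Kato, Astérisque 295 (2004), (12.5.1) and Rem. 12.7 (p. 222) (the excluded rows). [Kato2004Asterisque]
* Tree: `IwasawaTowerTorsionOrdinaryLocalProofs.lean` (the proved good-ordinary sibling, same conclusion shape),
  `Kato2004/IwasawaH2FineSelmerDualComparison.lean` / `Kato2004/IwasawaH2FineSelmerDualCount.lean` (consumers' `hfin`),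
  `GreenbergSelmer.lean` (`decomp`), `IwasawaMuInvariant.lean` (`ZpExtension.kerSubgroup`).
-/

noncomputable section

open scoped NumberField
open IsDedekindDomain Field
open Literature.NumberTheory.GaloisRepresentations

namespace Literature.NumberTheory.EllipticCurves

/-- **Imai 1975 (local form, potentially good reduction): `W(ℚ_{p,∞})[p^∞]` is finite.**  For every elliptic curve `W/ℚ`,
every prime `p` with `0 ≤ ord_p j(W)` (potentially good reduction at `p`, *AEC* VII.5.5), the cyclotomic `ℤ_p`-extension
`κ` of `ℚ` and the place `v` of `ℚ` at `p`, the fixed points of `ker κ ⊓ D_v` on `W(ℚ̄)[p^∞]` are finite — Imai's theorem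
(the torsion of `A(k(μ_{p^∞}))` is finite for an abelian variety `A` with good reduction over a finite `k/ℚ_p`) applied over a
field `k ⊇ ℚ_p` of good reduction of `W` (semistable reduction theorem), since `ℚ_{p,∞} ⊆ k(μ_{p^∞})`.  VERBATIM the
hypothesis `hfin` of `Kato2004.exists_iwasawaH2Data_fineSelmerDual_embedding{,_count}` under `0 ≤ ord_p j(W)`, and the
displayed schema `hImai` of the two cells' Kato-descent closers.  A named fact (D-0014), review-queued; weaker than print,
never stronger; nothing asserted where `ord_p j(W) < 0` (Kato (12.5.1)).  Proved in the tree at a good ORDINARY odd `p`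
(`WeierstrassCurve.finite_fixedPoints_kerSubgroup_inf_decomp_of_ordinary`) and, as `= 0`, on the rows with `W(ℚ_p)[p] = 0`.
[cite: Imai1975, Theorem (p. 12)] [cite: SilvermanAEC2009, Prop. VII.5.4 (c) and Prop. VII.5.5]
[cite: GreenbergLNM1716, §1 p. 62] -/
def imai1975_finite_fixedPoints_kerSubgroup_inf_decomp_of_padicValRat_j_nonneg : Prop :=
  ∀ (W : WeierstrassCurve ℚ) [W.IsElliptic] (p : ℕ) [Fact p.Prime] (κ : ZpExtension ℚ p)
    (v : HeightOneSpectrum (𝓞 ℚ)), 0 ≤ padicValRat p W.j → κ.IsCyclotomic →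
    ((Rat.HeightOneSpectrum.primesEquiv v : Nat.Primes) : ℕ) = p →
    Finite (FixedPoints.addSubgroup ↥(κ.kerSubgroup ⊓ GreenbergSelmer.decomp v) (W.geomPrimaryTorsion p))

end Literature.NumberTheory.EllipticCurves

end
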